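import Summits.CriticalPhenomena.SAWScalingLimit.Theorems.SAWRenewalTightnessSubseqIdentificationRestrictionAssembly
import Summits.CriticalPhenomena.SAWScalingLimit.Theorems.SAWRenewalTightnessSubseqIdentificationNecessity
import HarnessLib

/-!
# Exactness of the restriction residual of line `boundary-area-law`:
# `EventualTight → (SubseqIdentification ↔ IdentificationUpToKappa ∧ LatticeAreaUpperBound)`

Crux `SubseqIdentification` (stmt-CriticalPhenomena-0783), line `boundary-area-law`, lead c5. With the SLE side of the
restriction pin complete (RS5 p160681) and the composition landed (`SubseqIdentification_of_dock_of_upperBound`, p161410),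
the residual of the line is EXACT modulo the route's target T′ = `EventualTight`: the crux is EQUIVALENT to the pair
{S1 `IdentificationUpToKappa`, S4⁺ `LatticeAreaUpperBound`} (⇒ through the necessity package of lead c3, p130606:
crux ∧ T′ ⇒ `SAWScalingLimit` ⇒ S1 and the two-sided S4, whose upper half is S4⁺; ⇐ p161410), and at the summit level
`SAWScalingLimit ↔ EventualTight ∧ S1 ∧ S4⁺`. So replacing the two-sided lattice child `LatticeAreaLaw` of the prepared
split (strategist s1) by its ONE-SIDED upper half loses nothing and adds nothing — the tenure planner's `--resplit`.
No named fact is used.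
-/

noncomputable section

open MeasureTheory Filter Topology Set
open scoped NNReal ENNReal BoundedContinuousFunction
open Literature.Probability.RandomPlanarGeometry Literature.Probability.LatticeModels
open Literature.Probability.Process (preWienerMeasure)
open UpperHalfPlane (upperHalfPlaneSet)
open Summit.CriticalPhenomena.SAWScalingLimit.Theses.SAWParafermion (SubseqIdentification)
open Summit.CriticalPhenomena.SAWScalingLimit.Theses.SAWRenewalTightness (EventualTight closes)

namespace Summit.CriticalPhenomena.SAWScalingLimit.Theorems.SubseqIdentification.BoundaryAreaLaw

/-- **S4 ⇒ S4⁺**: the two-sided lattice area law implies its upper half (projection). [folklore] -/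
theorem latticeAreaUpperBound_of_latticeAreaLaw
    (h₄ : ∀ (D : DobrushinDomain) (a b : ℝ → Site 2), SAW.IsEndpointApprox D a b →
      ∀ (x₀ : ℂ) (ρ₀ : ℝ), 0 < ρ₀ →
        D.carrier ∩ Metric.ball x₀ ρ₀ = {z : ℂ | x₀.im < z.im} ∩ Metric.ball x₀ ρ₀ →
        x₀ ≠ D.pt 0 → x₀ ≠ D.pt 1 →
        ∃ C ε₀ : ℝ, 0 < C ∧ 0 < ε₀ ∧ ∀ r : ℝ, 0 < r → r ≤ ε₀ →
          ∀ᶠ δ in 𝓝[>] (0 : ℝ),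
            SAW.law D.carrier δ (a δ) (b δ) {γ | Metric.infDist x₀ γ.curve.range ≤ r} *
                ENNReal.ofReal (ε₀ ^ 2) ≤
              ENNReal.ofReal C *
                SAW.law D.carrier δ (a δ) (b δ) {γ | Metric.infDist x₀ γ.curve.range ≤ ε₀} *
                  ENNReal.ofReal (r ^ 2) ∧
            SAW.law D.carrier δ (a δ) (b δ) {γ | Metric.infDist x₀ γ.curve.range ≤ ε₀} *
                ENNReal.ofReal (r ^ 2) ≤
              ENNReal.ofReal C *
                SAW.law D.carrier δ (a δ) (b δ) {γ | Metric.infDist x₀ γ.curve.range ≤ r} *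
                  ENNReal.ofReal (ε₀ ^ 2)) :
    ∀ (D : DobrushinDomain) (a b : ℝ → Site 2), SAW.IsEndpointApprox D a b →
      ∀ (x₀ : ℂ) (ρ₀ : ℝ), 0 < ρ₀ →
        D.carrier ∩ Metric.ball x₀ ρ₀ = {z : ℂ | x₀.im < z.im} ∩ Metric.ball x₀ ρ₀ →
        x₀ ≠ D.pt 0 → x₀ ≠ D.pt 1 →
        ∃ C ε₀ : ℝ, 0 < C ∧ 0 < ε₀ ∧ ∀ r : ℝ, 0 < r → r ≤ ε₀ →
          ∀ᶠ δ in 𝓝[>] (0 : ℝ),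
            SAW.law D.carrier δ (a δ) (b δ) {γ | Metric.infDist x₀ γ.curve.range ≤ r} *
                ENNReal.ofReal (ε₀ ^ 2) ≤
              ENNReal.ofReal C *
                SAW.law D.carrier δ (a δ) (b δ) {γ | Metric.infDist x₀ γ.curve.range ≤ ε₀} *
                  ENNReal.ofReal (r ^ 2) := by
  intro D a b hab x₀ ρ₀ hρ₀ hwin hx0 hx1
  obtain ⟨C, ε₀, hC, hε₀, h⟩ := h₄ D a b hab x₀ ρ₀ hρ₀ hwin hx0 hx1
  exact ⟨C, ε₀, hC, hε₀, fun r hr hrε => (h r hr hrε).mono fun δ hδ => hδ.1⟩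

/-- **THE RESTRICTION RESIDUAL IS EXACT (registered): `EventualTight → (SubseqIdentification ↔ S1 ∧ S4⁺)`.**
(⇒: `subseqIdentification_iff_dock_and_latticeAreaLaw` of lead c3 and the projection S4 ⇒ S4⁺; ⇐: the landed
restriction composition `SubseqIdentification_of_dock_of_upperBound`.) [folklore] -/
theorem subseqIdentification_iff_dock_and_upperBound :
    EventualTight →
      (SubseqIdentification ↔
        ((∀ (s : ℕ → ℝ), Tendsto s atTop (𝓝[>] (0 : ℝ)) →
      ∃ κ : ℝ≥0, 0 < κ ∧
        ∀ (D : DobrushinDomain) (a b : ℝ → Site 2), SAW.IsEndpointApprox D a b →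
          ∀ (μ : Measure (CurveClass ℂ)), IsProbabilityMeasure μ →
            (∀ f : CurveClass ℂ →ᵇ ℝ,
              Tendsto (fun n => ∫ γ, f γ.curve ∂(SAW.law D.carrier (s n) (a (s n)) (b (s n))))
                atTop (𝓝 (∫ x, f x ∂μ))) →
            IsSLELaw κ D μ) ∧
         (∀ (D : DobrushinDomain) (a b : ℝ → Site 2), SAW.IsEndpointApprox D a b →
      ∀ (x₀ : ℂ) (ρ₀ : ℝ), 0 < ρ₀ →
        D.carrier ∩ Metric.ball x₀ ρ₀ = {z : ℂ | x₀.im < z.im} ∩ Metric.ball x₀ ρ₀ →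
        x₀ ≠ D.pt 0 → x₀ ≠ D.pt 1 →
        ∃ C ε₀ : ℝ, 0 < C ∧ 0 < ε₀ ∧ ∀ r : ℝ, 0 < r → r ≤ ε₀ →
          ∀ᶠ δ in 𝓝[>] (0 : ℝ),
            SAW.law D.carrier δ (a δ) (b δ) {γ | Metric.infDist x₀ γ.curve.range ≤ r} *
                ENNReal.ofReal (ε₀ ^ 2) ≤
              ENNReal.ofReal C *
                SAW.law D.carrier δ (a δ) (b δ) {γ | Metric.infDist x₀ γ.curve.range ≤ ε₀} *
                  ENNReal.ofReal (r ^ 2)))) :=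
  fun hT =>
    ⟨fun h =>
      ⟨((subseqIdentification_iff_dock_and_latticeAreaLaw hT).1 h).1,
        latticeAreaUpperBound_of_latticeAreaLaw ((subseqIdentification_iff_dock_and_latticeAreaLaw hT).1 h).2⟩,
      fun h => SubseqIdentification_of_dock_of_upperBound h.1 h.2 hT⟩

/-- **At the summit level: `SAWScalingLimit ↔ EventualTight ∧ S1 ∧ S4⁺`** (tightness ∧ conformal identification up to κ ∧
one-sided boundary rarity bound). [folklore] -/
theorem sawScalingLimit_iff_eventualTight_and_dock_and_upperBound :
    SAW.SAWScalingLimit ↔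
      (EventualTight ∧
        (∀ (s : ℕ → ℝ), Tendsto s atTop (𝓝[>] (0 : ℝ)) →
      ∃ κ : ℝ≥0, 0 < κ ∧
        ∀ (D : DobrushinDomain) (a b : ℝ → Site 2), SAW.IsEndpointApprox D a b →
          ∀ (μ : Measure (CurveClass ℂ)), IsProbabilityMeasure μ →
            (∀ f : CurveClass ℂ →ᵇ ℝ,
              Tendsto (fun n => ∫ γ, f γ.curve ∂(SAW.law D.carrier (s n) (a (s n)) (b (s n))))
                atTop (𝓝 (∫ x, f x ∂μ))) →
            IsSLELaw κ D μ) ∧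
        (∀ (D : DobrushinDomain) (a b : ℝ → Site 2), SAW.IsEndpointApprox D a b →
      ∀ (x₀ : ℂ) (ρ₀ : ℝ), 0 < ρ₀ →
        D.carrier ∩ Metric.ball x₀ ρ₀ = {z : ℂ | x₀.im < z.im} ∩ Metric.ball x₀ ρ₀ →
        x₀ ≠ D.pt 0 → x₀ ≠ D.pt 1 →
        ∃ C ε₀ : ℝ, 0 < C ∧ 0 < ε₀ ∧ ∀ r : ℝ, 0 < r → r ≤ ε₀ →
          ∀ᶠ δ in 𝓝[>] (0 : ℝ),
            SAW.law D.carrier δ (a δ) (b δ) {γ | Metric.infDist x₀ γ.curve.range ≤ r} *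
                ENNReal.ofReal (ε₀ ^ 2) ≤
              ENNReal.ofReal C *
                SAW.law D.carrier δ (a δ) (b δ) {γ | Metric.infDist x₀ γ.curve.range ≤ ε₀} *
                  ENNReal.ofReal (r ^ 2))) :=
  ⟨fun h =>
    have h3 := sawScalingLimit_iff_eventualTight_and_dock_and_latticeAreaLaw.1 h
    ⟨h3.1, h3.2.1, latticeAreaUpperBound_of_latticeAreaLaw h3.2.2⟩,
    fun h => closes h.1 (SubseqIdentification_of_dock_of_upperBound h.2.1 h.2.2 h.1)⟩

end Summit.CriticalPhenomena.SAWScalingLimit.Theorems.SubseqIdentification.BoundaryAreaLaw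

end
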